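import Summits.MatrixMultiplication.MatrixMultiplication.Theorems.FarEdgeDescentSpecialValue
import HarnessLib

/-!
# Far-edge descent, Kernel XI-c — the corank-one special stratum is an exact level set

Support for `Summit.MatrixMultiplication.MatrixMultiplication.Theses.FarEdgeDescent`
(aside `SubLogRate`; lens «structural dichotomy (special vs generic)», generation 36).

`FarEdgeDescentSpecialValue` capped the special stratum `V_S^{sp}` of the support class
`V_S = {T : supp T ⊆ supp 𝔖(1)}` by the special value `s = R̃(𝔖(0))` (pointwise `Φ ≤ Φ(𝔖(0))`
on the asymptotic spectrum).  This file makes the lens dichotomy QUANTITATIVE IN THE CORANK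
`c(T) := #{support entries of 𝔖(1) at which T vanishes}`, over every field `K`
(the last branch over every infinite field):

* `c(T) = 0` (GENERIC): `T` is a torus translate of some `𝔖(q)`, `q ≠ 0`, and
  `Φ(T) = Φ(𝔖(q))` for every universal `Φ` (X-d);
* `c(T) = 1` (CORANK ONE — the Zariski-open part of the special stratum):
  **`Φ(T) = Φ(𝔖(0))` for EVERY universal spectral point `Φ` and `R̃(T) = R̃(𝔖(0)) = s`
  exactly**, over every field (`spectralPoint_eq_fam_zero_of_corank_one`): by the normal form at
  the deleted entry (XI-b) and transport along the symmetries of `𝔖(1)`, every corank-one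
  member is a relabelled torus translate of `𝔖(0)`;
* `c(T) ≥ 2`: `Φ(T) ≤ Φ(𝔖(0))`, `R̃(T) ≤ s` (XI-b, infinite field).

So on `V_S` every point of the asymptotic spectrum is CONSTANT on each of the strata
`{c = 0, class q}` (value `Φ(𝔖(q))`) and `{c = 1}` (value `Φ(𝔖(0))`), and can only drop on
`{c ≥ 2}`: the «special vs generic» dichotomy of the lens is, on this class, the pair of numbers
`(r_gen, s)` with `r_gen − 1 ≤ s ≤ r_gen`, `s` attained on a dense open part of the special
stratum (`supportClass_levels`).  Also `zeroEntries (𝔖(0)) = {p₀}` (`c(𝔖(0)) = 1`).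

## References

* M. Bläser, M. Christandl, J. Zuiddam, *The border support rank of two-by-two matrix
  multiplication is seven*, arXiv:1705.09652 (2017), Lemma 3, Def. 5.
  [BlaserChristandlZuiddam2017]
* M. Christandl, K. Hoeberechts, H. Nieuwboer, P. Vrana, J. Zuiddam, *Asymptotic tensor rank is
  characterized by polynomials*, arXiv:2411.15789, Thm. 1.2, §3.
  [ChristandlHoeberechtsNieuwboerVranaZuiddam2025]
* V. Strassen, *The asymptotic spectrum of tensors*, J. reine angew. Math. 384 (1988), §2,
  Thm. 3.9. [Strassen1988]
-/

noncomputable section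

open scoped BigOperators

set_option linter.dupNamespace false

namespace Summit.MatrixMultiplication.MatrixMultiplication.Theorems.FarEdgeDescentSpecialLevel

open Literature.Computability.AlgebraicComplexity
open Summit.MatrixMultiplication.MatrixMultiplication.Theorems.FarEdgeDescentSignTwist
open Summit.MatrixMultiplication.MatrixMultiplication.Theorems.FarEdgeDescentSignTwistDet
open Summit.MatrixMultiplication.MatrixMultiplication.Theorems.FarEdgeDescentSignTwistComm
open Summit.MatrixMultiplication.MatrixMultiplication.Theorems.FarEdgeDescentSignTwistCommPow
open Summit.MatrixMultiplication.MatrixMultiplication.Theorems.FarEdgeDescentWeightFamily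
open Summit.MatrixMultiplication.MatrixMultiplication.Theorems.FarEdgeDescentRankOneCoupling
open Summit.MatrixMultiplication.MatrixMultiplication.Theorems.FarEdgeDescentSupportClass
open Summit.MatrixMultiplication.MatrixMultiplication.Theorems.FarEdgeDescentSpecialClass
open Summit.MatrixMultiplication.MatrixMultiplication.Theorems.FarEdgeDescentSpecialValue

/-! ## §1 Corank one at the deleted entry: an exact level set (every field) -/

section AnyField

variable {K : Type} [Field K]

/-- **Corank one at `p₀` pins every spectral value**: a tensor supported in `supp 𝔖(1)`,
vanishing at the deleted entry and non-zero on the rest of `supp 𝔖(0)` has `Φ(T) = Φ(𝔖(0))`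
for every universal spectral point `Φ` (normal form XI-b + torus invariance X-d).
[cite: BlaserChristandlZuiddam2017, Lemma 3] [cite: Strassen1988, §2] -/
theorem spectralPoint_eq_fam_zero_of_p₀ {Φ : SpectralMap K} (hΦ : IsUniversalSpectralPoint K Φ)
    {T : Leaf2 → (Fin 2 × Fin 2) → Leaf2 → K} (hT : ∀ a x c, fam K 1 a x c = 0 → T a x c = 0)
    (h0 : T (Sum.inr (1, 0)) (1, 0) (Sum.inr (0, 0)) = 0)
    (hfull : ∀ a x c, fam K 0 a x c ≠ 0 → T a x c ≠ 0) : Φ T = Φ (fam K 0) := by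
  obtain ⟨α, β, γ, hα, hβ, hγ, hEq⟩ := exists_scale_fam_zero hT h0 hfull
  rw [hEq, spectralPoint_scale_eq hΦ hα hβ hγ]

/-- … and `R̃(T) = R̃(𝔖(0))`. [cite: BlaserChristandlZuiddam2017, Lemma 3] -/
theorem asymptoticRank_eq_fam_zero_of_p₀ {T : Leaf2 → (Fin 2 × Fin 2) → Leaf2 → K}
    (hT : ∀ a x c, fam K 1 a x c = 0 → T a x c = 0)
    (h0 : T (Sum.inr (1, 0)) (1, 0) (Sum.inr (0, 0)) = 0)
    (hfull : ∀ a x c, fam K 0 a x c ≠ 0 → T a x c ≠ 0) :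
    asymptoticRank T = asymptoticRank (fam K 0) := by
  obtain ⟨α, β, γ, hα, hβ, hγ, hEq⟩ := exists_scale_fam_zero hT h0 hfull
  rw [hEq, asymptoticRank_scale_eq hα hβ hγ]

/-- "Every `T ∈ V_S` vanishing at the support entry `p` and at no other support entry has
`Φ(T) = Φ(𝔖(0))`." [folklore] -/
def LevelAt (Φ : SpectralMap K) (p : Leaf2 × (Fin 2 × Fin 2) × Leaf2) : Prop :=
  ∀ T : Leaf2 → (Fin 2 × Fin 2) → Leaf2 → K,
    (∀ a x c, fam K 1 a x c = 0 → T a x c = 0) → T p.1 p.2.1 p.2.2 = 0 →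
      (∀ a x c, fam K 1 a x c ≠ 0 → (a, x, c) ≠ p → T a x c ≠ 0) → Φ T = Φ (fam K 0)

/-- The level statement at the deleted entry `p₀ = pt 1 1 0`.
[cite: BlaserChristandlZuiddam2017, Lemma 3] -/
theorem levelAt_p₀ {Φ : SpectralMap K} (hΦ : IsUniversalSpectralPoint K Φ) :
    LevelAt Φ (pt 1 1 0) := by
  rw [pt_one_one_zero]
  intro T hT h0 hfull
  refine spectralPoint_eq_fam_zero_of_p₀ hΦ hT h0 fun a x c hne => hfull a x c
    (fun h1 => hne (fam_eq_zero_of_fam_one_eq_zero 0 h1)) fun heq => hne ?_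
  simp only [Prod.mk.injEq] at heq
  obtain ⟨rfl, rfl, rfl⟩ := heq
  exact fam_zero_p₀

/-- **Transport of level statements** along a symmetry of `𝔖(1)` (injectivity moves the
"no other zero" hypothesis). [cite: Strassen1988, §2] -/
theorem levelAt_transport {Φ : SpectralMap K} (hΦ : IsUniversalSpectralPoint K Φ)
    {e₁ e₃ : Leaf2 ≃ Leaf2} {e₂ : (Fin 2 × Fin 2) ≃ (Fin 2 × Fin 2)}
    (he : (fun a x c => fam K 1 (e₁ a) (e₂ x) (e₃ c)) = fam K 1)
    {p : Leaf2 × (Fin 2 × Fin 2) × Leaf2} (H : LevelAt Φ p) :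
    LevelAt Φ (e₁ p.1, e₂ p.2.1, e₃ p.2.2) := by
  intro T hT h0 hfull
  have he' : ∀ a x c, fam K 1 (e₁ a) (e₂ x) (e₃ c) = fam K 1 a x c := fun a x c =>
    congrFun (congrFun (congrFun he a) x) c
  have hT' : ∀ a x c, fam K 1 a x c = 0 → T (e₁ a) (e₂ x) (e₃ c) = 0 := fun a x c h =>
    hT _ _ _ (by rw [he']; exact h)
  have hfull' : ∀ a x c, fam K 1 a x c ≠ 0 → (a, x, c) ≠ p → T (e₁ a) (e₂ x) (e₃ c) ≠ 0 :=
    fun a x c hne hp => hfull _ _ _ (by rw [he']; exact hne) fun heq => hp (by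
      simp only [Prod.mk.injEq, EmbeddingLike.apply_eq_iff_eq] at heq
      exact Prod.ext heq.1 (Prod.ext heq.2.1 heq.2.2))
  have h := H (fun a x c => T (e₁ a) (e₂ x) (e₃ c)) hT' h0 hfull'
  rwa [spectralPoint_reindex hΦ T e₁ e₂ e₃] at h

/-- Transport across the side swap: level at `pt 1 i k` ⇒ level at `pt 0 i k`. [folklore] -/
theorem levelAt_side {Φ : SpectralMap K} (hΦ : IsUniversalSpectralPoint K Φ) {i k : Fin 2}
    (H : LevelAt Φ (pt 1 i k)) : LevelAt Φ (pt 0 i k) := by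
  have h := levelAt_transport hΦ (fam_one_sideSwap (K := K)) H
  rwa [sideSwap_pt] at h

/-- Transport across the first row flip: level at `pt σ 1 k` ⇒ level at `pt σ 0 k`.
[folklore] -/
theorem levelAt_row {Φ : SpectralMap K} (hΦ : IsUniversalSpectralPoint K Φ) {σ k : Fin 2}
    (H : LevelAt Φ (pt σ 1 k)) : LevelAt Φ (pt σ 0 k) := by
  have h := levelAt_transport hΦ (fam_one_flipRow (K := K)) H
  rwa [flipRow_pt] at h

/-- Transport across the second row flip: level at `pt σ i 0` ⇒ level at `pt σ i 1`.
[folklore] -/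
theorem levelAt_col {Φ : SpectralMap K} (hΦ : IsUniversalSpectralPoint K Φ) {σ i : Fin 2}
    (H : LevelAt Φ (pt σ i 0)) : LevelAt Φ (pt σ i 1) := by
  have h := levelAt_transport hΦ (fam_one_flipCol (K := K)) H
  rwa [flipCol_pt] at h

/-- The level statement holds at all eight support entries. [folklore] -/
theorem levelAt_all {Φ : SpectralMap K} (hΦ : IsUniversalSpectralPoint K Φ) :
    ∀ σ i k, LevelAt Φ (pt σ i k) := by
  have b := levelAt_p₀ hΦ
  intro σ i k
  fin_cases σ <;> fin_cases i <;> fin_cases k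
  · exact levelAt_side hΦ (levelAt_row hΦ b)
  · exact levelAt_side hΦ (levelAt_row hΦ (levelAt_col hΦ b))
  · exact levelAt_side hΦ b
  · exact levelAt_side hΦ (levelAt_col hΦ b)
  · exact levelAt_row hΦ b
  · exact levelAt_row hΦ (levelAt_col hΦ b)
  · exact b
  · exact levelAt_col hΦ b

/-- **The corank-one special stratum is an exact level set of every spectral point**: if
`T ∈ V_S` vanishes at exactly one support entry of `𝔖(1)`, then `Φ(T) = Φ(𝔖(0))` for every
universal spectral point `Φ`, over every field.
[cite: BlaserChristandlZuiddam2017, Lemma 3] [cite: Strassen1988, §2] -/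
theorem spectralPoint_eq_fam_zero_of_corank_one {Φ : SpectralMap K}
    (hΦ : IsUniversalSpectralPoint K Φ) {T : Leaf2 → (Fin 2 × Fin 2) → Leaf2 → K}
    (hT : ∀ a x c, fam K 1 a x c = 0 → T a x c = 0) {a₀ : Leaf2} {x₀ : Fin 2 × Fin 2}
    {c₀ : Leaf2} (hne : fam K 1 a₀ x₀ c₀ ≠ 0) (h0 : T a₀ x₀ c₀ = 0)
    (hfull : ∀ a x c, fam K 1 a x c ≠ 0 → (a, x, c) ≠ (a₀, x₀, c₀) → T a x c ≠ 0) :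
    Φ T = Φ (fam K 0) := by
  obtain ⟨σ, i, k, hp⟩ := exists_pt_of_cond a₀ x₀ c₀ ((fam_one_ne_zero_iff a₀ x₀ c₀).1 hne)
  have h := levelAt_all hΦ σ i k T hT
  rw [← hp] at h
  exact h h0 hfull

/-- … hence `R̃(T) = R̃(𝔖(0)) = s` for every corank-one member (Strassen duality, both ways).
[cite: ChristandlHoeberechtsNieuwboerVranaZuiddam2025, Thm. 1.2] [cite: Strassen1988, Thm. 3.9] -/
theorem asymptoticRank_eq_fam_zero_of_corank_one {T : Leaf2 → (Fin 2 × Fin 2) → Leaf2 → K}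
    (hT : ∀ a x c, fam K 1 a x c = 0 → T a x c = 0) {a₀ : Leaf2} {x₀ : Fin 2 × Fin 2}
    {c₀ : Leaf2} (hne : fam K 1 a₀ x₀ c₀ ≠ 0) (h0 : T a₀ x₀ c₀ = 0)
    (hfull : ∀ a x c, fam K 1 a x c ≠ 0 → (a, x, c) ≠ (a₀, x₀, c₀) → T a x c ≠ 0) :
    asymptoticRank T = asymptoticRank (fam K 0) := by
  apply le_antisymm
  · obtain ⟨F, hF, hFT⟩ := (strassen_duality_asymptoticRank_holds K T).2
    rw [← hFT, spectralPoint_eq_fam_zero_of_corank_one hF hT hne h0 hfull]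
    exact (strassen_duality_asymptoticRank_holds K (fam K 0)).1 F hF
  · obtain ⟨F, hF, hF0⟩ := (strassen_duality_asymptoticRank_holds K (fam K 0)).2
    rw [← hF0, ← spectralPoint_eq_fam_zero_of_corank_one hF hT hne h0 hfull]
    exact (strassen_duality_asymptoticRank_holds K T).1 F hF

/-! ## §2 The corank count and the three strata -/

open Classical in
/-- The support entries of `𝔖(1)` at which `T` vanishes (the corank set of `T ∈ V_S`).
[cite: BlaserChristandlZuiddam2017, Lemma 3] -/
def zeroEntries (T : Leaf2 → (Fin 2 × Fin 2) → Leaf2 → K) :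
    Finset (Leaf2 × (Fin 2 × Fin 2) × Leaf2) :=
  Finset.univ.filter fun z => fam K 1 z.1 z.2.1 z.2.2 ≠ 0 ∧ T z.1 z.2.1 z.2.2 = 0

/-- Membership in the corank set. [cite: BlaserChristandlZuiddam2017, Lemma 3] -/
theorem mem_zeroEntries (T : Leaf2 → (Fin 2 × Fin 2) → Leaf2 → K)
    (z : Leaf2 × (Fin 2 × Fin 2) × Leaf2) :
    z ∈ zeroEntries T ↔ fam K 1 z.1 z.2.1 z.2.2 ≠ 0 ∧ T z.1 z.2.1 z.2.2 = 0 := by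
  simp [zeroEntries]

/-- `c(𝔖(0)) = 1`: the zero-weight member vanishes exactly at the deleted entry.
[cite: BlaserChristandlZuiddam2017, Def. 5] -/
theorem zeroEntries_fam_zero :
    zeroEntries (fam K 0) = {(Sum.inr (1, 0), (1, 0), Sum.inr (0, 0))} := by
  ext z
  rw [mem_zeroEntries, Finset.mem_singleton]
  constructor
  · rintro ⟨h1, h0⟩
    rcases fam_one_eq_zero_or_isP0 h0 with h | ⟨ha, hx, hc⟩
    · exact absurd h h1
    · exact Prod.ext ha (Prod.ext hx hc)
  · rintro rfl
    exact ⟨by rw [fam_one_p₀]; exact one_ne_zero, fam_zero_p₀⟩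

/-- **Corank zero = generic**: no vanishing support entry means full support, hence a torus
translate of some `𝔖(q)`, `q ≠ 0`, with the same value under every universal `Φ` and the same
`R̃`. [cite: BlaserChristandlZuiddam2017, Lemma 3] -/
theorem of_zeroEntries_eq_empty {T : Leaf2 → (Fin 2 × Fin 2) → Leaf2 → K}
    (hT : ∀ a x c, fam K 1 a x c = 0 → T a x c = 0) (h : zeroEntries T = ∅) :
    ∃ q : K, q ≠ 0 ∧ asymptoticRank T = asymptoticRank (fam K q) ∧
      ∀ Φ : SpectralMap K, IsUniversalSpectralPoint K Φ → Φ T = Φ (fam K q) := by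
  have hS : SameSupport T (fam K 1) := fun a x c =>
    ⟨fun hne h1 => hne (hT a x c h1), fun h1 hz => by
      simpa [h] using (mem_zeroEntries T (a, x, c)).2 ⟨h1, hz⟩⟩
  obtain ⟨α, β, γ, q, hα, hβ, hγ, hq, hEq⟩ := exists_scale_fam_of_sameSupport hS
  refine ⟨q, hq, ?_, fun Φ hΦ => ?_⟩
  · rw [hEq, asymptoticRank_scale_eq hα hβ hγ]
  · rw [hEq, spectralPoint_scale_eq hΦ hα hβ hγ]

/-- **Corank one = the level set of the special value**: exactly one vanishing support entry
gives `Φ(T) = Φ(𝔖(0))` for every universal `Φ` and `R̃(T) = R̃(𝔖(0))`, over every field.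
[cite: BlaserChristandlZuiddam2017, Lemma 3] [cite: Strassen1988, Thm. 3.9] -/
theorem of_zeroEntries_card_eq_one {T : Leaf2 → (Fin 2 × Fin 2) → Leaf2 → K}
    (hT : ∀ a x c, fam K 1 a x c = 0 → T a x c = 0) (h : (zeroEntries T).card = 1) :
    asymptoticRank T = asymptoticRank (fam K 0) ∧
      ∀ Φ : SpectralMap K, IsUniversalSpectralPoint K Φ → Φ T = Φ (fam K 0) := by
  obtain ⟨p, hp⟩ := Finset.card_eq_one.1 h
  obtain ⟨a₀, x₀, c₀⟩ := p
  have hmem := (mem_zeroEntries T _).1 (hp ▸ Finset.mem_singleton_self _)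
  have hfull : ∀ a x c, fam K 1 a x c ≠ 0 → (a, x, c) ≠ (a₀, x₀, c₀) → T a x c ≠ 0 :=
    fun a x c hne hne' hz => hne' (Finset.mem_singleton.1 (hp ▸ (mem_zeroEntries T _).2
      ⟨hne, hz⟩))
  exact ⟨asymptoticRank_eq_fam_zero_of_corank_one hT hmem.1 hmem.2 hfull,
    fun Φ hΦ => spectralPoint_eq_fam_zero_of_corank_one hΦ hT hmem.1 hmem.2 hfull⟩

/-- **Positive corank = special**: a vanishing support entry caps `Φ(T) ≤ Φ(𝔖(0))` and
`R̃(T) ≤ R̃(𝔖(0))` (infinite field, XI-b).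
[cite: ChristandlHoeberechtsNieuwboerVranaZuiddam2025, Thm. 1.2, §3] -/
theorem of_zeroEntries_nonempty [Infinite K] {T : Leaf2 → (Fin 2 × Fin 2) → Leaf2 → K}
    (hT : ∀ a x c, fam K 1 a x c = 0 → T a x c = 0) (h : (zeroEntries T).Nonempty) :
    asymptoticRank T ≤ asymptoticRank (fam K 0) ∧
      ∀ Φ : SpectralMap K, IsUniversalSpectralPoint K Φ → Φ T ≤ Φ (fam K 0) := by
  obtain ⟨⟨a, x, c⟩, hz⟩ := h
  have hmem := (mem_zeroEntries T _).1 hz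
  have hsp : IsSpecial T := ⟨hT, a, x, c, hmem.1, hmem.2⟩
  exact ⟨asymptoticRank_le_fam_zero_of_isSpecial hsp,
    fun Φ hΦ => spectralPoint_le_fam_zero_of_isSpecial hΦ hsp⟩

/-- **The support class by corank** (infinite field): for `T ∈ V_S` with corank `c(T)`,
`c = 0 ⟹ R̃(T) = R̃(𝔖(q))` for some `q ≠ 0`; `c = 1 ⟹ R̃(T) = R̃(𝔖(0)) = s`;
`c ≥ 2 ⟹ R̃(T) ≤ s`.  The special value is attained on the whole corank-one stratum.
[cite: BlaserChristandlZuiddam2017, Lemma 3]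
[cite: ChristandlHoeberechtsNieuwboerVranaZuiddam2025, Thm. 1.2] -/
theorem supportClass_levels [Infinite K] {T : Leaf2 → (Fin 2 × Fin 2) → Leaf2 → K}
    (hT : ∀ a x c, fam K 1 a x c = 0 → T a x c = 0) :
    ((zeroEntries T).card = 0 ∧ ∃ q : K, q ≠ 0 ∧ asymptoticRank T = asymptoticRank (fam K q)) ∨
      ((zeroEntries T).card = 1 ∧ asymptoticRank T = asymptoticRank (fam K 0)) ∨
        (2 ≤ (zeroEntries T).card ∧ asymptoticRank T ≤ asymptoticRank (fam K 0)) := by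
  rcases Nat.lt_or_ge (zeroEntries T).card 2 with hlt | hge
  · rcases Nat.lt_or_ge (zeroEntries T).card 1 with h0 | h1
    · have hc : (zeroEntries T).card = 0 := by omega
      obtain ⟨q, hq, hR, -⟩ := of_zeroEntries_eq_empty hT (Finset.card_eq_zero.1 hc)
      exact Or.inl ⟨hc, q, hq, hR⟩
    · have hc : (zeroEntries T).card = 1 := by omega
      exact Or.inr (Or.inl ⟨hc, (of_zeroEntries_card_eq_one hT hc).1⟩)
  · refine Or.inr (Or.inr ⟨hge, (of_zeroEntries_nonempty hT ?_).1⟩)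
    exact Finset.card_pos.1 (by omega)

/-- **Pointwise version of the corank stratification**: every universal spectral point is
constant (`= Φ(𝔖(q))`, resp. `= Φ(𝔖(0))`) on the corank-`0` class of `q` and on the corank-one
stratum, and at most `Φ(𝔖(0))` in corank `≥ 2`. [cite: Strassen1988, §2]
[cite: ChristandlHoeberechtsNieuwboerVranaZuiddam2025, §3] -/
theorem supportClass_levels_spectral [Infinite K] {Φ : SpectralMap K}
    (hΦ : IsUniversalSpectralPoint K Φ) {T : Leaf2 → (Fin 2 × Fin 2) → Leaf2 → K}
    (hT : ∀ a x c, fam K 1 a x c = 0 → T a x c = 0) :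
    ((zeroEntries T).card = 0 ∧ ∃ q : K, q ≠ 0 ∧ Φ T = Φ (fam K q)) ∨
      ((zeroEntries T).card = 1 ∧ Φ T = Φ (fam K 0)) ∨
        (2 ≤ (zeroEntries T).card ∧ Φ T ≤ Φ (fam K 0)) := by
  rcases Nat.lt_or_ge (zeroEntries T).card 2 with hlt | hge
  · rcases Nat.lt_or_ge (zeroEntries T).card 1 with h0 | h1
    · have hc : (zeroEntries T).card = 0 := by omega
      obtain ⟨q, hq, -, hΦq⟩ := of_zeroEntries_eq_empty hT (Finset.card_eq_zero.1 hc)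
      exact Or.inl ⟨hc, q, hq, hΦq Φ hΦ⟩
    · have hc : (zeroEntries T).card = 1 := by omega
      exact Or.inr (Or.inl ⟨hc, (of_zeroEntries_card_eq_one hT hc).2 Φ hΦ⟩)
  · refine Or.inr (Or.inr ⟨hge, (of_zeroEntries_nonempty hT ?_).2 Φ hΦ⟩)
    exact Finset.card_pos.1 (by omega)

end AnyField

end Summit.MatrixMultiplication.MatrixMultiplication.Theorems.FarEdgeDescentSpecialLevel

end
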